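import Literature.Analysis.FunctionSpaces.PVPrograms
import Literature.Analysis.FunctionSpaces.PVTheory
import Literature.Computability.MetaComplexity.BoundedArithUnivTheory
import Literature.Computability.MetaComplexity.BoundedArithStandardModel
import Literature.ModelTheory.UniversalTheories.HerbrandSaturation
import HarnessLib

/-!
# Models of the true universal theory of `(ℕ, PV)`: transfer, characteristic terms, Skolem symbols

Support for the model-theoretic proof of Buss's witnessing theorem in `PV` form
(`Σᵇ₁`-definable in `S₂¹` ⇒ `PV`-definable): Krajíček 1995, Thm. 7.6.3 and pp. 116–117 (after
Zambella 1996), Avigad 2002, §3–4.  The universal theory of the Herbrand-saturation route is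
taken to be the **true universal theory** `trueUnivPV` of the standard model `(ℕ, PV)` in the
language `L(PV)` (`Language.pv`, one symbol for every description of a polynomial-time function
in Cobham's algebra): all universal `L(PV)`-sentences true in `ℕ`.  It contains Cook's `PV` and
`BASIC`; a "fact" usable in a model `K ⊨ trueUnivPV` is any universal sentence verified in `ℕ`,
i.e. an identity of `PVFun.eval` (`PVPrograms.lean`, `PVTables.lean`).

* `trueUnivPV`, `realize_of_nat` (**transfer** of universal formulas from `ℕ` to `K`),
  `model_BASIC_of_trueUnivPV` (`K ⊨ BASIC` on the reduct, so that the ordered-semiring façade of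
  `BoundedArithAlgebra` is available in `K`);
* `papp f v` — a symbol applied in `K`; `papp_sel_of_le/lt` (definition by cases in `K`);
  `termSym` (every term in variables `Fin m` is a symbol) with `papp_termSym`;
* `charTerm φ` — characteristic terms of open `L(PV)`-formulas, `realize_charTerm`
  (Krajíček 1995, §5.3: open formulas of `PV` have characteristic terms);
* **Skolem terms and symbols in Herbrand-saturated models** (`exists_skolem_term`,
  `exists_skolem_sym`): if `K` is Herbrand saturated and `K ⊨ ∀x̄ ∃y φ(x̄, y)` with `φ` open
  (parameters allowed) then `K ⊨ ∀x̄ φ(x̄, G(c̄, x̄))` for a symbol `G` and parameters `c̄`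
  (Avigad 2002, Thm. 3.3, plus definition by cases) — verbatim the argument of
  `BoundedArithUnivSkolem.lean` for the language `L(PV)`;
* monotonicity of the terms of Buss's language in `K` (`realize_mono`).

## References

* J. Krajíček, *Bounded Arithmetic, Propositional Logic and Complexity Theory*, CUP 1995, §5.3,
  §7.6 (Thm. 7.6.3, pp. 116–117).
* J. Avigad, *Saturated models of universal theories*, APAL 118 (2002), §3 (Thm. 3.3), §4.
* D. Zambella, *Notes on polynomially bounded arithmetic*, JSL 61 (1996).

## Design choices

* `trueUnivPV` is the strongest universal theory in `L(PV)` true in `ℕ`; the witnessing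
  argument only ever needs soundness in `ℕ`, so nothing is lost and every verification happens in
  `ℕ` by `simp` with the `eval` lemmas.
* The setting for `K` is that of `BoundedArithUnivTheory.lean`: `K` carries structures for both
  languages with `boundedArithToPV` an expansion on `K` (for a bare `Language.pv`-structure take
  the reduct), and `[K ⊨ BASIC]` as an instance argument where the façade is used.
-/

namespace Literature.Analysis.FunctionSpaces

open FirstOrder FirstOrder.Language FirstOrder.Language.BoundedFormula
open Literature.Computability.MetaComplexity Literature.Computability.MetaComplexity.BASICModel
open Literature.ModelTheory.UniversalTheories

/-! ## The theory and transfer -/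

section Theory

/-- **The true universal theory of `(ℕ, PV)`**: all universal `L(PV)`-sentences true in the
standard model.  It contains the (universal) theory `PV` of Cook 1975 and Buss's `BASIC`
(Krajíček 1995, Def. 5.3.1 and §7.6). [cite: Krajicek1995, §7.6] -/
def trueUnivPV : Language.pv.Theory :=
  {σ | BoundedFormula.IsUniversal σ ∧ ℕ ⊨ σ}

/-- `trueUnivPV` is a universal theory. [folklore] -/
instance isUniversal_trueUnivPV : (trueUnivPV).IsUniversal := ⟨fun _ h => h.1⟩

/-- `ℕ ⊨ trueUnivPV`. [folklore] -/
theorem model_nat_trueUnivPV : ℕ ⊨ trueUnivPV := ⟨fun _ h => h.2⟩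

variable {K : Type} [Language.pv.Structure K]

/-- **Transfer.** A universal `L(PV)`-formula (context variables, no parameters) true in `ℕ`
under every assignment is true in every model of `trueUnivPV` under every assignment.
[folklore] -/
theorem realize_of_nat (hK : K ⊨ trueUnivPV) {n : ℕ} {ψ : Language.pv.BoundedFormula Empty n}
    (hψ : ψ.IsUniversal) (h : ∀ xs : Fin n → ℕ, ψ.Realize default xs) (xs : Fin n → K) :
    ψ.Realize default xs := by
  have hmem : ψ.alls ∈ trueUnivPV := by
    refine ⟨hψ.alls, ?_⟩
    simp only [Sentence.Realize, realize_alls]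
    intro xs
    convert h xs
  have hKs : K ⊨ ψ.alls := hK.realize_of_mem _ hmem
  simp only [Sentence.Realize, realize_alls] at hKs
  convert hKs xs

/-- A symbol applied to a tuple, in a `Language.pv`-structure. [folklore] -/
abbrev papp {n : ℕ} (f : PVFun n) (v : Fin n → K) : K := Structure.funMap (L := Language.pv) f v

/-- The `i`-th context variable as an `L(PV)`-term. [folklore] -/
abbrev cv {n : ℕ} (i : Fin n) : Language.pv.Term (Empty ⊕ Fin n) := Term.var (Sum.inr i)

/-- A term of Buss's language as an `L(PV)`-term. [folklore] -/
abbrev ιt {α : Type} (t : Language.boundedArith.Term α) : Language.pv.Term α :=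
  boundedArithToPV.onTerm t

/-- The numeral `1` as an `L(PV)`-term (image of Buss's `S0`). [folklore] -/
abbrev pone {α : Type} : Language.pv.Term α := ιt (natConst 1)

omit [Language.pv.Structure K] in
/-- In `ℕ`, a symbol applied to a tuple is `eval`. [folklore] -/
@[simp] theorem papp_nat {n : ℕ} (f : PVFun n) (v : Fin n → ℕ) : papp f v = f.eval v := rfl

/-! ### Every term is a symbol -/

/-- **Every `L(PV)`-term in the variables `Fin m` is a symbol**: variables are projections and
`f(t₀, …, t_{l-1})` is the composition `comp f (…)`. [folklore] -/
def termSym {m : ℕ} : Language.pv.Term (Fin m) → PVFun m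
  | Term.var i => PVFun.proj i
  | Term.func f ts => PVFun.comp f fun i => termSym (ts i)

omit [Language.pv.Structure K] in
/-- In `ℕ`, `termSym t` evaluates as `t`. [folklore] -/
theorem eval_termSym {m : ℕ} : ∀ (t : Language.pv.Term (Fin m)) (v : Fin m → ℕ),
    (termSym t).eval v = t.realize v
  | Term.var i, v => by simp [termSym]
  | Term.func f ts, v => by
    simp only [termSym, PVFun.eval_comp, Term.realize, funMap_pv]
    congr 1
    funext i
    exact eval_termSym (ts i) v

/-- **Fact (term symbols).** In a model of `trueUnivPV`, `termSym t` denotes the term `t`.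
[folklore] -/
theorem papp_termSym (hK : K ⊨ trueUnivPV) {m : ℕ} (t : Language.pv.Term (Fin m))
    (v : Fin m → K) : papp (termSym t) v = t.realize v := by
  let Ψ : Language.pv.BoundedFormula Empty m :=
    Term.bdEqual (Term.func (termSym t) fun i => cv i) (t.relabel Sum.inr)
  have hΨ : Ψ.IsUniversal := (IsAtomic.equal _ _).isQF.isUniversal
  have hfact := realize_of_nat hK hΨ (fun u => by
    simp only [Ψ, realize_bdEqual, Term.realize, Sum.elim_inr, Term.realize_relabel,
      Sum.elim_comp_inr, funMap_pv, eval_termSym]) v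
  simp only [Ψ, realize_bdEqual, Term.realize, Sum.elim_inr, Term.realize_relabel,
    Sum.elim_comp_inr] at hfact
  exact hfact

end Theory

/-! ## The two-language setting: `BASIC`, `≤`, Buss's symbols -/

section Setting

variable {K : Type} [Language.boundedArith.Structure K] [Language.pv.Structure K]
  [boundedArithToPV.IsExpansionOn K]

/-- Transfer for sentences of Buss's language: a universal `Language.boundedArith`-sentence true
in `ℕ` holds in (the reduct of) every model of `trueUnivPV`. [folklore] -/
theorem realize_sentence_of_nat (hK : K ⊨ trueUnivPV) {σ : Language.boundedArith.Sentence}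
    (hσ : BoundedFormula.IsUniversal σ) (h : ℕ ⊨ σ) : K ⊨ σ := by
  have hmem : boundedArithToPV.onSentence σ ∈ trueUnivPV :=
    ⟨hσ.onBoundedFormula _, (realize_onSentence_boundedArithToPV σ).2 h⟩
  exact (LHom.realize_onSentence K boundedArithToPV σ).1 (hK.realize_of_mem _ hmem)

/-- **A model of `trueUnivPV` is a model of `BASIC`** (on its reduct to Buss's language): the
axioms of `BASIC` are universal and true in `ℕ`. [cite: Buss1986, §2.2] -/
theorem model_BASIC_of_trueUnivPV (hK : K ⊨ trueUnivPV) : K ⊨ BASIC :=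
  ⟨fun _ hσ => realize_sentence_of_nat hK (isUniversal_of_mem_BASIC hσ)
    ((model_nat_BASIC_holds).realize_of_mem _ hσ)⟩

/-- In `K`, a term of Buss's language denotes what it denotes in the reduct. [folklore] -/
@[simp] theorem realize_ιt {α : Type} (t : Language.boundedArith.Term α) (v : α → K) :
    (ιt t).realize v = t.realize v :=
  LHom.realize_onTerm _ _ _

/-- In `K`, the `PV` symbol of a Buss symbol is interpreted as in the reduct. [folklore] -/
theorem papp_toPV {n : ℕ} (f : BoundedArithFunc n) (v : Fin n → K) :
    papp (BoundedArithFunc.toPV f) v = Structure.funMap (L := Language.boundedArith) f v :=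
  (LHom.IsExpansionOn.map_onFunction (ϕ := boundedArithToPV) (M := K) f v)

/-- In `K`, `PVFun.half` is `mHalf`. [folklore] -/
@[simp] theorem papp_half (a : K) : papp PVFun.half ![a] = mHalf a := papp_toPV BoundedArithFunc.half ![a]

/-- In `K`, `PVFun.len` is `mLen`. [folklore] -/
@[simp] theorem papp_len (a : K) : papp PVFun.len ![a] = mLen a := papp_toPV BoundedArithFunc.len ![a]

/-- In `K`, `PVFun.add` is `mAdd`. [folklore] -/
@[simp] theorem papp_add (a b : K) : papp PVFun.add ![a, b] = mAdd a b :=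
  papp_toPV BoundedArithFunc.add ![a, b]

/-- In `K`, `PVFun.mul` is `mMul`. [folklore] -/
@[simp] theorem papp_mul (a b : K) : papp PVFun.mul ![a, b] = mMul a b :=
  papp_toPV BoundedArithFunc.mul ![a, b]

/-- In `K`, `PVFun.smash` is `mSmash`. [folklore] -/
@[simp] theorem papp_smash (a b : K) : papp PVFun.smash ![a, b] = mSmash a b :=
  papp_toPV BoundedArithFunc.smash ![a, b]

/-- In `K`, `PVFun.succ` is `mSucc`. [folklore] -/
@[simp] theorem papp_succ (a : K) : papp PVFun.succ ![a] = mSucc a := papp_toPV BoundedArithFunc.succ ![a]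

/-- In `K`, `PVFun.zero` is `mZero`. [folklore] -/
@[simp] theorem papp_zero (v : Fin 0 → K) : papp PVFun.zero v = mZero K := by
  rw [Subsingleton.elim v default]
  exact papp_toPV BoundedArithFunc.zero default

variable [hKB : K ⊨ BASIC]

/-- In `K`, an atomic inequality of `L(PV)`-terms means `≤` (of the reduct). [folklore] -/
@[simp] theorem realize_pvle {α : Type} {m : ℕ} (s₁ s₂ : Language.pv.Term (α ⊕ Fin m)) (w : α → K)
    (xs : Fin m → K) :
    (Term.le s₁ s₂ : Language.pv.BoundedFormula α m).Realize w xs ↔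
      s₁.realize (Sum.elim w xs) ≤ s₂.realize (Sum.elim w xs) := by
  rw [Term.le, realize_rel₂]
  have h := LHom.IsExpansionOn.map_onRelation (ϕ := boundedArithToPV) (M := K) BoundedArithRel.le
    ![s₁.realize (Sum.elim w xs), s₂.realize (Sum.elim w xs)]
  exact (Iff.of_eq h).trans (mLe_iff _ _)

omit hKB in
/-- In `K`, the numeral `1` denotes `1`. [folklore] -/
@[simp] theorem realize_pone [K ⊨ BASIC] {α : Type} (v : α → K) :
    (pone : Language.pv.Term α).realize v = 1 := by
  show (ιt (natConst 1) : Language.pv.Term α).realize v = 1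
  rw [realize_ιt, realize_natConst_one, mSucc_eq, mZero_eq, zero_add]

/-! ### Definition by cases in `K` -/

/-- **Fact (definition by cases).** In `K`: `a ≤ b → sel (a, b, c, d) = c` and
`b < a → sel (a, b, c, d) = d`. [cite: Cook1975, §2] -/
theorem papp_sel_spec (hK : K ⊨ trueUnivPV) (w : Fin 4 → K) :
    (w 0 ≤ w 1 → papp PVFun.sel w = w 2) ∧ (w 1 < w 0 → papp PVFun.sel w = w 3) := by
  let sv : Language.pv.Term (Empty ⊕ Fin 4) := Term.func PVFun.sel fun i => cv i
  let Ψ : Language.pv.BoundedFormula Empty 4 :=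
    (Term.le (cv 0) (cv 1) ⟹ Term.bdEqual sv (cv 2)) ⊓
      (∼(Term.le (cv 0) (cv 1)) ⟹ Term.bdEqual sv (cv 3))
  have hΨ : Ψ.IsUniversal :=
    (((IsAtomic.rel _ _).isQF.imp (IsAtomic.equal _ _).isQF).inf
      ((IsAtomic.rel _ _).isQF.not.imp (IsAtomic.equal _ _).isQF)).isUniversal
  have hfact := realize_of_nat hK hΨ (fun u => by
    simp only [Ψ, sv, realize_inf, realize_imp, realize_not, realize_bdEqual, Term.realize_le,
      Term.realize, Sum.elim_inr, funMap_pv, PVFun.eval_sel]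
    constructor
    · intro h; rw [if_pos h]
    · intro h; rw [if_neg h]) w
  simp only [Ψ, sv, realize_inf, realize_imp, realize_not, realize_bdEqual, realize_pvle,
    Term.realize, Sum.elim_inr, not_le] at hfact
  exact hfact

/-- `sel (a, b, c, d) = c` if `a ≤ b` (in `K`). [cite: Cook1975, §2] -/
theorem papp_sel_of_le (hK : K ⊨ trueUnivPV) {a b : K} (h : a ≤ b) (c d : K) :
    papp PVFun.sel ![a, b, c, d] = c :=
  (papp_sel_spec hK ![a, b, c, d]).1 h

/-- `sel (a, b, c, d) = d` if `b < a` (in `K`). [cite: Cook1975, §2] -/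
theorem papp_sel_of_lt (hK : K ⊨ trueUnivPV) {a b : K} (h : b < a) (c d : K) :
    papp PVFun.sel ![a, b, c, d] = d :=
  (papp_sel_spec hK ![a, b, c, d]).2 h

/-! ## Characteristic terms of open formulas -/

section CharTerm

variable {α : Type}

/-- The selector applied to four terms. [folklore] -/
def selT (a b c d : Language.pv.Term α) : Language.pv.Term α :=
  Term.func PVFun.sel ![a, b, c, d]

/-- **The characteristic term of a formula** (by recursion on the formula; quantifiers are sent
to `0`, so this is meaningful for open formulas): `χ(t₁ = t₂) = sel(t₁,t₂,sel(t₂,t₁,1,0),0)`,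
`χ(t₁ ≤ t₂) = sel(t₁,t₂,1,0)`, `χ(⊥) = 0`, `χ(φ → ψ) = sel(χ φ, 0, 1, χ ψ)`
(Krajíček 1995, §5.3: open formulas of `PV` have characteristic terms). [cite: Krajicek1995, §5.3] -/
def charTerm : {n : ℕ} → Language.pv.BoundedFormula α n → Language.pv.Term (α ⊕ Fin n)
  | _, falsum => ιt 0
  | _, equal t₁ t₂ => selT t₁ t₂ (selT t₂ t₁ pone (ιt 0)) (ιt 0)
  | _, rel (l := 2) .le ts => selT (ts 0) (ts 1) pone (ιt 0)
  | _, imp φ ψ => selT (charTerm φ) (ιt 0) pone (charTerm ψ)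
  | _, all _ => ιt 0

/-- `charTerm` of `⊥`. [folklore] -/
@[simp] theorem charTerm_falsum {n : ℕ} :
    charTerm (falsum : Language.pv.BoundedFormula α n) = ιt 0 := rfl

/-- `charTerm` of an equation. [folklore] -/
@[simp] theorem charTerm_equal {n : ℕ} (t₁ t₂ : Language.pv.Term (α ⊕ Fin n)) :
    charTerm (equal t₁ t₂) = selT t₁ t₂ (selT t₂ t₁ pone (ιt 0)) (ιt 0) := rfl

/-- `charTerm` of an inequality (`Relations.boundedFormula` form). [folklore] -/
@[simp] theorem charTerm_le {n : ℕ} (ts : Fin 2 → Language.pv.Term (α ⊕ Fin n)) :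
    charTerm (Relations.boundedFormula (BoundedArithRel.le : Language.pv.Relations 2) ts) =
      selT (ts 0) (ts 1) pone (ιt 0) := rfl

/-- `charTerm` of an implication. [folklore] -/
@[simp] theorem charTerm_imp {n : ℕ} (φ ψ : Language.pv.BoundedFormula α n) :
    charTerm (φ.imp ψ) = selT (charTerm φ) (ιt 0) pone (charTerm ψ) := rfl

/-- Semantics of `selT` in `K`. [folklore] -/
theorem realize_selT (hK : K ⊨ trueUnivPV) (a b c d : Language.pv.Term α) (v : α → K) :
    (selT a b c d).realize v =
      if a.realize v ≤ b.realize v then c.realize v else d.realize v := by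
  rw [selT, QSym.realize_func_vec4]
  split_ifs with hle
  · exact papp_sel_of_le hK hle _ _
  · exact papp_sel_of_lt hK (not_le.1 hle) _ _

/-- In `K`, the relation symbol `≤` of `L(PV)` means `≤`. [folklore] -/
theorem relMap_pvle_iff (w : Fin 2 → K) :
    Structure.RelMap (L := Language.pv) BoundedArithRel.le w ↔ w 0 ≤ w 1 := by
  have h := LHom.IsExpansionOn.map_onRelation (ϕ := boundedArithToPV) (M := K) BoundedArithRel.le w
  rw [← mLe_iff]
  have e : w = ![w 0, w 1] := by funext i; fin_cases i <;> rfl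
  refine (Iff.of_eq h).trans ?_
  conv_lhs => rw [e]
  rfl

/-- **Correctness of characteristic terms** in `K`: for an open formula `φ`, `χ_φ = 1 ↔ φ`, and
`χ_φ ∈ {0, 1}`. [cite: Krajicek1995, §5.3] -/
theorem realize_charTerm (hK : K ⊨ trueUnivPV) {n : ℕ} {φ : Language.pv.BoundedFormula α n}
    (hφ : φ.IsQF) (v : α → K) (xs : Fin n → K) :
    ((charTerm φ).realize (Sum.elim v xs) = 1 ↔ φ.Realize v xs) ∧
      ((charTerm φ).realize (Sum.elim v xs) = 0 ∨ (charTerm φ).realize (Sum.elim v xs) = 1) := by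
  have h01 : (0 : K) ≠ 1 := zero_ne_one
  have h10 : ¬ ((1 : K) ≤ 0) := not_le.2 zero_lt_one
  induction hφ with
  | falsum =>
    simp only [charTerm_falsum, realize_ιt, realize_term_zero, mZero_eq]
    exact ⟨⟨fun h => absurd h h01, fun h => h.elim⟩, by simp⟩
  | of_isAtomic h =>
    cases h with
    | equal t₁ t₂ =>
      simp only [Term.bdEqual, charTerm_equal, realize_selT hK, realize_ιt, realize_term_zero,
        realize_natConst_one, mSucc_eq, mZero_eq, zero_add]
      refine ⟨⟨fun h => ?_, fun h => ?_⟩, ?_⟩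
      · split_ifs at h with h1 h2
        · exact le_antisymm h1 h2
        · exact absurd h h01
        · exact absurd h h01
      · rw [h, if_pos le_rfl, if_pos le_rfl]
      · split_ifs <;> simp
    | rel R ts =>
      cases R with
      | le =>
        simp only [charTerm_le, realize_selT hK, realize_ιt, realize_term_zero, realize_natConst_one,
          mSucc_eq, mZero_eq, zero_add, BoundedFormula.realize_rel, relMap_pvle_iff]
        refine ⟨⟨fun h => ?_, fun h => ?_⟩, ?_⟩
        · split_ifs at h with h1
          · exact h1
          · exact absurd h h01
        · rw [if_pos h]
        · split_ifs <;> simp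
  | imp h₁ h₂ ih₁ ih₂ =>
    obtain ⟨i1, c1⟩ := ih₁
    obtain ⟨i2, c2⟩ := ih₂
    simp only [charTerm_imp, realize_selT hK, realize_ιt, realize_term_zero, realize_natConst_one,
      mSucc_eq, mZero_eq, zero_add, realize_imp]
    rcases c1 with h0 | h1
    · have hφ : ¬ _ := fun h => h01 (h0.symm.trans (i1.2 h))
      rw [h0, if_pos le_rfl]
      exact ⟨⟨fun _ h => absurd h hφ, fun _ => rfl⟩, Or.inr rfl⟩
    · have hφ := i1.1 h1
      rw [h1, if_neg h10]
      exact ⟨⟨fun h _ => i2.1 h, fun h => i2.2 (h hφ)⟩, c2⟩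

omit [Language.boundedArith.Structure K] [boundedArithToPV.IsExpansionOn K] hKB in
/-- In `ℕ`, `selT` is definition by cases. [folklore] -/
@[simp] theorem realize_selT_nat (a b c d : Language.pv.Term α) (v : α → ℕ) :
    (selT a b c d).realize v = if a.realize v ≤ b.realize v then c.realize v else d.realize v := by
  rw [selT, QSym.realize_func_vec4, funMap_pv, PVFun.eval_sel]
  simp

omit [Language.boundedArith.Structure K] [boundedArithToPV.IsExpansionOn K] hKB in
/-- **Correctness of characteristic terms in `ℕ`.** [cite: Krajicek1995, §5.3] -/
theorem realize_charTerm_nat {n : ℕ} {φ : Language.pv.BoundedFormula α n}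
    (hφ : φ.IsQF) (v : α → ℕ) (xs : Fin n → ℕ) :
    ((charTerm φ).realize (Sum.elim v xs) = 1 ↔ φ.Realize v xs) ∧
      ((charTerm φ).realize (Sum.elim v xs) = 0 ∨ (charTerm φ).realize (Sum.elim v xs) = 1) := by
  have h01 : (0 : ℕ) ≠ 1 := by decide
  have h10 : ¬ ((1 : ℕ) ≤ 0) := by decide
  induction hφ with
  | falsum =>
    simp only [charTerm_falsum, ιt, LHom.realize_onTerm, Literature.Computability.MetaComplexity.realize_zero]
    exact ⟨⟨fun h => absurd h h01, fun h => h.elim⟩, by simp⟩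
  | of_isAtomic h =>
    cases h with
    | equal t₁ t₂ =>
      simp only [Term.bdEqual, charTerm_equal, realize_selT_nat, ιt, pone, LHom.realize_onTerm,
        Literature.Computability.MetaComplexity.realize_zero, realize_natConst]
      refine ⟨⟨fun h => ?_, fun h => ?_⟩, ?_⟩
      · split_ifs at h with h1 h2
        exact le_antisymm h1 h2
      · rw [h, if_pos le_rfl, if_pos le_rfl]
      · split_ifs <;> simp
    | rel R ts =>
      cases R with
      | le =>
        simp only [charTerm_le, realize_selT_nat, ιt, pone, LHom.realize_onTerm,
          Literature.Computability.MetaComplexity.realize_zero, realize_natConst,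
          BoundedFormula.realize_rel, relMap_pv_le]
        refine ⟨⟨fun h => ?_, fun h => ?_⟩, ?_⟩
        · split_ifs at h with h1
          exact h1
        · rw [if_pos h]
        · split_ifs <;> simp
  | imp h₁ h₂ ih₁ ih₂ =>
    obtain ⟨i1, c1⟩ := ih₁
    obtain ⟨i2, c2⟩ := ih₂
    simp only [charTerm_imp, realize_selT_nat, ιt, pone, LHom.realize_onTerm,
      Literature.Computability.MetaComplexity.realize_zero, realize_natConst, realize_imp]
    rcases c1 with h0 | h1
    · have hφ : ¬ _ := fun h => h01 (h0.symm.trans (i1.2 h))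
      rw [h0, if_pos le_rfl]
      exact ⟨⟨fun _ h => absurd h hφ, fun _ => rfl⟩, Or.inr rfl⟩
    · have hφ := i1.1 h1
      rw [h1, if_neg h10]
      exact ⟨⟨fun h _ => i2.1 h, fun h => i2.2 (h hφ)⟩, c2⟩

end CharTerm

/-! ## Skolem terms and symbols from Herbrand saturation -/

section Skolem

variable {kk : ℕ}

/-- The candidate selection: given candidate terms `tt₁, …, tt_N` for the existential variable of
`φ(x̄, y)`, the term "the first `ttᵢ(x̄)` with `φ(x̄, ttᵢ(x̄))`, else `0`". [folklore] -/
def skolemChain (φ : Language.pv.BoundedFormula (K ⊕ Fin kk) 1) :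
    List (Fin 1 → Language.pv.Term (K ⊕ Fin kk)) → Language.pv.Term (K ⊕ Fin kk)
  | [] => ιt 0
  | tt :: rest =>
    selT ((charTerm φ).subst (Sum.elim Term.var fun _ => tt 0)) (ιt 0) (skolemChain φ rest) (tt 0)

/-- Correctness of the candidate selection. [folklore] -/
theorem realize_skolemChain (hK : K ⊨ trueUnivPV)
    {φ : Language.pv.BoundedFormula (K ⊕ Fin kk) 1} (hφ : φ.IsQF)
    (L : List (Fin 1 → Language.pv.Term (K ⊕ Fin kk))) (xs : Fin kk → K)
    (h : ∃ tt ∈ L, φ.Realize (Sum.elim id xs) fun j => (tt j).realize (Sum.elim id xs)) :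
    φ.Realize (Sum.elim id xs) ![(skolemChain φ L).realize (Sum.elim id xs)] := by
  induction L with
  | nil => simp at h
  | cons tt rest ih =>
    have hc := realize_charTerm hK hφ (Sum.elim id xs) ![(tt 0).realize (Sum.elim id xs)]
    have e1 : (fun j : Fin 1 => (tt j).realize (Sum.elim (id : K → K) xs)) =
        ![(tt 0).realize (Sum.elim id xs)] := by
      funext j; fin_cases j; rfl
    have ec : ((charTerm φ).subst (Sum.elim Term.var fun _ => tt 0)).realize (Sum.elim id xs) =
        (charTerm φ).realize (Sum.elim (Sum.elim id xs) ![(tt 0).realize (Sum.elim id xs)]) := by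
      rw [Term.realize_subst]
      congr 1
      funext a
      rcases a with a | j
      · rfl
      · fin_cases j; rfl
    rw [skolemChain, realize_selT hK, ec]
    simp only [realize_ιt, realize_term_zero, mZero_eq]
    by_cases hφt : φ.Realize (Sum.elim id xs) ![(tt 0).realize (Sum.elim id xs)]
    · have h1 := hc.1.2 hφt
      rw [h1, if_neg (not_le.2 zero_lt_one)]
      exact hφt
    · have h0 : (charTerm φ).realize (Sum.elim (Sum.elim id xs) ![(tt 0).realize (Sum.elim id xs)]) = 0 :=
        (hc.2.resolve_right fun h1 => hφt (hc.1.1 h1))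
      rw [h0, if_pos le_rfl]
      refine ih ?_
      obtain ⟨tt', htt', hφ'⟩ := h
      rcases List.mem_cons.1 htt' with rfl | hmem
      · rw [e1] at hφ'; exact absurd hφ' hφt
      · exact ⟨tt', hmem, hφ'⟩

/-- **Skolem terms in a Herbrand-saturated model of `trueUnivPV`.** If `K` is Herbrand
saturated and `K ⊨ ∀ x̄ ∃ y φ(x̄, y)` with `φ` open (parameters from `K` allowed), then
`K ⊨ ∀ x̄ φ(x̄, τ(x̄))` for some term `τ` (Herbrand's theorem in `K`, Avigad 2002, Theorem 3.3,
plus definition by cases). [cite: Avigad2002, Theorem 3.3] -/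
theorem exists_skolem_term (hK : K ⊨ trueUnivPV)
    (hsat : IsHerbrandSaturated Language.pv K)
    {φ : Language.pv.BoundedFormula (K ⊕ Fin kk) 1} (hφ : φ.IsQF)
    (h : ∀ xs : Fin kk → K, ∃ y : K, φ.Realize (Sum.elim id xs) ![y]) :
    ∃ τ : Language.pv.Term (K ⊕ Fin kk),
      ∀ xs : Fin kk → K, φ.Realize (Sum.elim id xs) ![τ.realize (Sum.elim id xs)] := by
  classical
  haveI : Nonempty K := ⟨0⟩
  obtain ⟨s, hs⟩ := hsat.exists_finset_term φ hφ fun xs => by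
    obtain ⟨y, hy⟩ := h xs
    exact ⟨![y], hy⟩
  refine ⟨skolemChain φ s.toList, fun xs => realize_skolemChain hK hφ _ xs ?_⟩
  obtain ⟨tt, htt, hφt⟩ := hs xs
  exact ⟨tt, Finset.mem_toList.2 htt, hφt⟩

omit [Language.boundedArith.Structure K] [boundedArithToPV.IsExpansionOn K] hKB in
/-- **Extracting the parameters of a term**: a term with parameters from `K` is a parameter-free
term applied to a tuple of parameters. [folklore] -/
theorem exists_param_term [Inhabited K] (τ : Language.pv.Term (K ⊕ Fin kk)) :
    ∃ (q : ℕ) (c : Fin q → K) (τ' : Language.pv.Term (Fin (q + kk))),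
      ∀ xs : Fin kk → K, τ.realize (Sum.elim id xs) = τ'.realize (Fin.append c xs) := by
  classical
  let S : Finset K := τ.varFinsetLeft
  let e := S.equivFin
  let f : K → Fin (S.card + 1) := fun a =>
    if h : a ∈ S then Fin.castSucc (e ⟨a, h⟩) else Fin.last _
  let c : Fin (S.card + 1) → K := Fin.snoc (fun i => (e.symm i).1) default
  refine ⟨S.card + 1, c, (τ.relabel (Sum.map f id)).relabel finSumFinEquiv, fun xs => ?_⟩
  rw [Term.realize_relabel, Term.realize_relabel]
  have e1 : (Fin.append c xs ∘ ⇑finSumFinEquiv) = Sum.elim c xs := by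
    funext x
    rcases x with i | j
    · simp [finSumFinEquiv_apply_left]
    · simp [finSumFinEquiv_apply_right]
  rw [e1, Sum.elim_comp_map, Function.comp_id]
  refine realize_term_congr_left τ xs fun a ha => ?_
  simp only [Function.comp_apply, f, c]
  rw [dif_pos ha, Fin.snoc_castSucc]
  simp

/-- **Skolem symbols.** In a Herbrand-saturated model of `trueUnivPV`, if
`K ⊨ ∀ x̄ ∃ y φ(x̄, y)` with `φ` open (parameters allowed) then there are a symbol `G` and
parameters `c̄` with `K ⊨ ∀ x̄ φ(x̄, G(c̄, x̄))`. [cite: Avigad2002, Theorem 3.3] -/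
theorem exists_skolem_sym (hK : K ⊨ trueUnivPV) (hsat : IsHerbrandSaturated Language.pv K)
    {φ : Language.pv.BoundedFormula (K ⊕ Fin kk) 1} (hφ : φ.IsQF)
    (h : ∀ xs : Fin kk → K, ∃ y : K, φ.Realize (Sum.elim id xs) ![y]) :
    ∃ (q : ℕ) (c : Fin q → K) (G : PVFun (q + kk)),
      ∀ xs : Fin kk → K, φ.Realize (Sum.elim id xs) ![papp G (Fin.append c xs)] := by
  haveI : Inhabited K := ⟨0⟩
  obtain ⟨τ, hτ⟩ := exists_skolem_term hK hsat hφ h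
  obtain ⟨q, c, τ', hτ'⟩ := exists_param_term τ
  refine ⟨q, c, termSym τ', fun xs => ?_⟩
  rw [papp_termSym hK, ← hτ']
  exact hτ xs

end Skolem

/-! ## Monotonicity of the terms of Buss's language -/

section Mono

/-- **`⌊·/2⌋` is monotone in `K`** (true in `ℕ`, transferred). [folklore] -/
theorem mHalf_mono (hK : K ⊨ trueUnivPV) {a b : K} (h : a ≤ b) : mHalf a ≤ mHalf b := by
  let σ : Language.boundedArith.Sentence :=
    BoundedFormula.alls (n := 2) (Term.le (&0) (&1) ⟹ Term.le (Term.half (&0)) (Term.half (&1)))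
  have hσ : BoundedFormula.IsUniversal σ :=
    BoundedFormula.IsQF.isUniversal_alls ((IsAtomic.rel _ _).isQF.imp (IsAtomic.rel _ _).isQF)
  have hKσ := realize_sentence_of_nat hK hσ (by
    simp only [σ, Sentence.Realize, realize_alls, realize_imp, realize_le',
      realize_term_half, mLe_nat, mHalf_nat]
    intro xs hle
    exact Nat.div_le_div_right hle)
  simp only [σ, Sentence.Realize, realize_alls, realize_imp, realize_le',
    realize_term_half, mLe_iff] at hKσ
  exact hKσ ![a, b] h

/-- **`#` is monotone in `K`** (true in `ℕ`, transferred). [folklore] -/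
theorem mSmash_mono (hK : K ⊨ trueUnivPV) {a a' b b' : K} (ha : a ≤ a') (hb : b ≤ b') :
    mSmash a b ≤ mSmash a' b' := by
  let σ : Language.boundedArith.Sentence :=
    BoundedFormula.alls (n := 4) ((Term.le (&0) (&1) ⊓ Term.le (&2) (&3)) ⟹
      Term.le (Term.smash (&0) (&2)) (Term.smash (&1) (&3)))
  have hσ : BoundedFormula.IsUniversal σ :=
    BoundedFormula.IsQF.isUniversal_alls
      (((IsAtomic.rel _ _).isQF.inf (IsAtomic.rel _ _).isQF).imp (IsAtomic.rel _ _).isQF)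
  have hKσ := realize_sentence_of_nat hK hσ (by
    simp only [σ, Sentence.Realize, realize_alls, realize_imp, realize_inf,
      realize_le', realize_term_smash, mLe_nat, mSmash_nat]
    rintro xs ⟨h1, h2⟩
    exact Nat.pow_le_pow_right two_pos
      (Nat.mul_le_mul (Nat.size_le_size h1) (Nat.size_le_size h2)))
  simp only [σ, Sentence.Realize, realize_alls, realize_imp, realize_inf,
    realize_le', realize_term_smash, mLe_iff] at hKσ
  exact hKσ ![a, a', b, b'] ⟨ha, hb⟩

/-- **The terms of Buss's language are monotone in `K`**: pointwise larger arguments give a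
larger value. [cite: Buss1986, §2.2] -/
theorem realize_mono (hK : K ⊨ trueUnivPV) {α : Type} (t : Language.boundedArith.Term α)
    {v v' : α → K} (h : ∀ a, v a ≤ v' a) : t.realize v ≤ t.realize v' := by
  induction t with
  | var a => exact h a
  | func f ts ih =>
    simp only [Term.realize]
    have e1 : ∀ (w : Fin 1 → K), w = ![w 0] := fun w => by funext i; fin_cases i; rfl
    have e2 : ∀ (w : Fin 2 → K), w = ![w 0, w 1] := fun w => by funext i; fin_cases i <;> rfl
    cases f with
    | zero => exact le_of_eq (congrArg _ (funext fun i => Fin.elim0 i))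
    | succ =>
      rw [e1 (fun i => (ts i).realize v), e1 (fun i => (ts i).realize v')]
      change mSucc _ ≤ mSucc _
      rw [mSucc_eq, mSucc_eq]
      exact add_le_add (ih 0) le_rfl
    | half =>
      rw [e1 (fun i => (ts i).realize v), e1 (fun i => (ts i).realize v')]
      exact mHalf_mono hK (ih 0)
    | len =>
      rw [e1 (fun i => (ts i).realize v), e1 (fun i => (ts i).realize v')]
      exact mLen_le_mLen (ih 0)
    | add =>
      rw [e2 (fun i => (ts i).realize v), e2 (fun i => (ts i).realize v')]
      change mAdd _ _ ≤ mAdd _ _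
      rw [mAdd_eq, mAdd_eq]
      exact add_le_add (ih 0) (ih 1)
    | mul =>
      rw [e2 (fun i => (ts i).realize v), e2 (fun i => (ts i).realize v')]
      change mMul _ _ ≤ mMul _ _
      rw [mMul_eq, mMul_eq]
      exact mul_le_mul'' (ih 0) (ih 1)
    | smash =>
      rw [e2 (fun i => (ts i).realize v), e2 (fun i => (ts i).realize v')]
      exact mSmash_mono hK (ih 0) (ih 1)

end Mono

end Setting

end Literature.Analysis.FunctionSpaces
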